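import Literature.NumberTheory.EllipticCurves.Rank1Residual.Typed.PAdicCertificateReducibleMultiplicativeCanonical
import Summits.BirchSwinnertonDyer.Rank1Residual.X2.ClassClosureO9
import Literature.NumberTheory.EllipticCurves.SteinWuthrich2013.SplitMultCanonicalHolds
import Literature.NumberTheory.EllipticCurves.SteinWuthrich2013.NonsplitMultCanonicalHolds
import HarnessLib

/-!
# Row B11 = cell X2c (rank 1, Eisenstein, `p ‖ N`): the PARITY-FREE, SIGN-FREE, PREPRINT-FREE per-pair
# road «lever L3» as two DATUM-FREE doors — `BSD(E,p)` from Kato–Wuthrich divisibility + the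
# Stein–Wuthrich leading term + THREE instrument readings (cell `bsd-eis`, seat `bsd-eis-k5-p3` gen 0;
# route `EisensteinPrimes`, crux 4 `BSDpOnCellC` = stmt-BirchSwinnertonDyer-19034; THEOREMS ONLY)

HONEST FRAMING (FULL-BSD rank-≤1 programme D-0033 / D-0131 (3) middle tier, cell `bsd-eis`, home
`run/shared/lean/pub/bsd-eis/`; row B11 = X2c: 12 665 census cells `(E, p)` with `r_an = 1`, `p` odd,
`p ‖ N`, `E[p]` reducible; O9 atlas `class-closure/O9/E2-hypotheses.tsv`). Nothing is booked here and no
label or count moves: X2c stays CONSTRUCTION-SHAPED as a class (crux 4 is OPEN); BSD is proved for no curve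
by this file unconditionally. Seat lens (director-bsd g9, D-0131 (3)): «Eisenstein main conjecture
⊆-half beyond CGLS via Kato + Greenberg–Vatsal μ-part bookkeeping on the open B11 cells».

WHAT THIS FILE IS. The tree's certificate theorems
`Literature.…Rank1Residual.Typed.X2.bsdp_of_thm16mult_split_of_canonical_certificate` /
`…nonsplit…` (`Typed/PAdicCertificateReducibleMultiplicativeCanonical.lean`, b2b-bsdres literature seat
gen 5; «lever L3» of RESIDUAL-CASES.md) give `BSD(E,p)` at a REDUCIBLE multiplicative `p ≠ 2` in analytic
rank `≤ 1` from PUBLISHED facts ONLY — Wuthrich 2014 Thm. 16 (Kato's divisibility `char_Λ X(E) ∣ (L_p(E))`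
integrally, resp. `I · char ∣ (L_p)` at a split prime: the ⊆-half of Mazur's main conjecture at an
Eisenstein prime, with NO image, parity, anomaly or level hypothesis), Stein–Wuthrich 2013 Thm. 6.1
(the algebraic leading term; the former Jones hypothesis `hLT` DISCHARGED there), Gross–Zagier–Kolyvagin,
Barré-Sirieix–Diaz–Gramain–Philibert (`𝓛_p ≠ 0`, tree theorem `LInvariant_ne_zero_holds`) — plus a
per-pair `p`-adic CERTIFICATE (`hordL`, `hcert`) and `p ∤ #Ш_an`. Those theorems take the bookkeeping
data (`κ, γ, f, D, ϖ, L, Dq/q, Dh`) as explicit arguments. This file QUANTIFIES THE DATA INSIDE (every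
datum exists by a tree theorem: cyclotomic `(κ, γ)`, a Selmer-dual datum, the modular parametrisation
datum and its newform `f` with `ϖ > 0`, THE split / non-split Mazur–Tate–Teitelbaum function `L`, the Tate
parameter, THE Stein–Wuthrich §4.2 height `Dh` — `exists_isSplitMultCanonical_holds` /
`exists_isMultCanonical_holds`) and states the two doors on the O9 cell predicate `X2.CellC W p` with the
readings in the grammar of the cell's booked per-pair roads (`X2.bsdp_of_cellC_of_not_split_of_lamMin`,
`…_of_gvPar_of_orderOne_of_facts`, seat k5-c4): the per-pair hypotheses left are EXACTLY
* `hcert` — for THE function `L` (pinned by `IsSplitMultPAdicLFunctionOf f p L`, resp.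
  `IsMultPAdicLFunctionOf f p (-1) L`) and THE §4.2 height: `ord_{T=0} L = 2` (split) / `= 1` (non-split)
  AND `v_p(ϖ·[T^{1+e}]L·log_p(γ_cyc)^{1+e}·#E(ℚ)_tors²) = v_p(𝓛_p·∏c_v·Reg_p)` (split) /
  `= v_p(2·∏c_v·Reg_p)` (non-split) — i.e. the `p`-adic BSD quotient `S_p` of Stein–Wuthrich Conj. 5.1 is
  a `p`-adic UNIT at the pair (instruments of record in the lane: bsd-formula-census REG-MULT two-engine
  heights at `p ‖ N`, PARI `ellpadicbsd`/`ellpadicL`/`ellpadicregulator` ‖ the PARI-free msengine +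
  `swreg.py` of b2b-bsdres-x11b `p3cert/` — 111/111 X11 pairs at `3 ‖ N`, 75 split);
* `hsha` — the rational `#Ш_an(E)` is a `p`-adic unit (Cremona `allbsd`; O9 atlas: `ord_p #Ш_an = 0` on
  12 663 of the 12 665 B11 cells).
No Greenberg–Vatsal parity (both ψ-parities), no split/non-split restriction beyond choosing the door,
no λ-minimality, no partner / relative / twist, no anticyclotomic object, no Schneider hypothesis (the
certificate implies it), no `_OPEN` / preprint fact, no crux 3: KELLER–YIN-FREE on all four O9 sub-cells
(`CellCSplitNotGV` 7 728 · `CellCSplitGV` 1 774 · `CellCNonsplitGV` 1 599 · `CellCNonsplitNotGV` 1 564),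
whereas every B11 booking of record except the λ-minimal road (R723, 2 060 cells) is literal on
Keller–Yin 2024 Thm. D (registers `KY24-ThmD@X2c-even` 9 292, `@X2c-odd-twc` 2 327 keys).

* §1 `bsdp_of_cellC_of_split_of_thm16_of_l3Certificate` — split `p`: `CellC W p ∧ split ∧ hcert ∧ hsha ⟹ BSDp W p`.
* §2 `bsdp_of_cellC_of_not_split_of_thm16_of_l3Certificate` — non-split `p`: the same with `e = 0`.
Class-level binders, all REGISTERED Literature facts BY NAME: `hWu` Wuthrich 2014 Thm. 16 (multiplicative
clauses), `hJs`/`hJn` Stein–Wuthrich 2013 Thm. 6.1, `hGZ` Gross–Zagier I.7.3 (rationality of `#Ш_an`),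
`hGZK` rank = analytic rank ≤ 1 with `Ш` finite, `hpar` modular parametrisation.

What this is NOT: not a class theorem (the readings are per pair); not a booking; not the crux
`BSDpOnCellC`; the 2 cells with `p ∣ #Ш_an` are out of reach of this road (they need a main-conjecture
EQUALITY: GV at a ψ-odd pair / crux 3 at a ψ-even pair).
Refs: [Wuthrich2014] Thm. 16 (p. 397), Cor. 18; [SteinWuthrich2013] Thm. 6.1 (p. 20), §4.2, Conj. 5.1;
[Miller2011LMS] Def. 1.1, Prop. 7.6; [MazurTateTeitelbaum1986Invent] §I.13, §II.10;
cell files k5-c4-MEMO-6 §6 V9 («lever L3 … not attempted»), b2b `b2b-bsdres-x11b/p3cert/README.md`,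
`ttrl/bsd-formula-census/REGMULT-TABLE.md`.
-/

set_option autoImplicit false
set_option linter.dupNamespace false

noncomputable section

open scoped Classical MatrixGroups ModularForm

open WeierstrassCurve PowerSeries CongruenceSubgroup
  Literature.NumberTheory.EllipticCurves
  Literature.NumberTheory.EllipticCurves.ModularForms
  Literature.NumberTheory.EllipticCurves.Rank1Residual
  Literature.NumberTheory.EllipticCurves.Rank1Residual.Typed
  Literature.NumberTheory.EllipticCurves.Wuthrich2014
  Literature.NumberTheory.EllipticCurves.SteinWuthrich2013
  Literature.NumberTheory.EllipticCurves.Disegni2020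
  Summit.BirchSwinnertonDyer.Rank1Residual
  Summit.BirchSwinnertonDyer.Rank1Residual.X2

namespace Summit.BirchSwinnertonDyer.BirchSwinnertonDyer.Theorems.B11L3

variable (W : WeierstrassCurve ℚ) [W.IsElliptic] [W.IsGloballyMinimal] (p : ℕ) [Fact p.Prime]

/-! ## §1 Split multiplicative `p` (exceptional zero: `ord_{T=0} L = 2`) -/

/-- **X2c, SPLIT `p ‖ N`: `BSD(E,p)` from Kato–Wuthrich + Stein–Wuthrich + the pair's L3 certificate —
datum-free door.** Class-level inputs BY NAME: Wuthrich 2014 Thm. 16 (`hWu`), Stein–Wuthrich 2013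
Thm. 6.1 split (`hJs`), Gross–Zagier I.7.3 (`hGZ`), GZK (`hGZK`), modular parametrisation (`hpar`); tree
theorems used inside: `exists_isSplitMultCanonical_holds` (THE §4.2 height exists), `LInvariant_ne_zero_holds`,
`exists_isSplitMultPAdicLFunctionOf`, `nonempty_tateParameterData_iff_holds`. Per-pair inputs: `CellC W p`
(rank reading + kernel membership), `split`, the certificate `hcert` for THE split Mazur–Tate–Teitelbaum
function and THE §4.2 height (`ord_{T=0} L = 2` and
`v_p(ϖ·[T²]L·log_p(γ_cyc)²·#tors²) = v_p(𝓛_p·∏c_v·Reg_p)`), and `hsha` (`p ∤ #Ш_an`).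
[cite: Wuthrich2014, Thm. 16 (p. 397)] [cite: SteinWuthrich2013, Thm. 6.1 (p. 20) and §4.2]
[cite: Miller2011LMS, Def. 1.1 and Prop. 7.6] -/
theorem bsdp_of_cellC_of_split_of_thm16_of_l3Certificate
    (hWu : thm16_charIdeal_dvd_multiplicative_of_reducible) (hJs : thm61_splitMultiplicative)
    (hGZ : GrossZagier1986_thm_I_7_3) (hGZK : rank_eq_analyticRank_of_analyticRank_le_one)
    (hpar : nonempty_modularParametrizationData)
    (hc : CellC W p) (hsplit : W.HasSplitMultiplicativeReductionAtPrime p)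
    (hcert : ∀ {N : ℕ} [NeZero N] (f : CuspForm (Gamma0 N) 2), IsNewformOf W f →
      ∀ (ϖ : ℚ), (ϖ : ℝ) * W.realPeriodRat = plusPeriod f →
      ∀ (L : PowerSeries ℚ_[p]), IsSplitMultPAdicLFunctionOf f p L →
      ∀ (Dq : TateParameterData W p) (Dh : PAdicHeightData W p), IsSplitMultCanonical Dh Dq →
        L.order = ((2 : ℕ) : ℕ∞) ∧
        (((ϖ : ℚ) : ℚ_[p]) * PowerSeries.coeff 2 L *
            (padicLog p (cyclotomicGenerator p) ^ 2 * (W.torsionOrder : ℚ_[p]) ^ 2)).valuation =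
          (LInvariant Dq * (W.tamagawaProduct : ℚ_[p]) * padicRegulator Dh).valuation)
    (hsha : ∀ s : ℚ, shaAn W = (s : ℂ) → padicValRat p s = 0) :
    BSDp W p := by
  have hX : ClassX2 W p := hc.2
  obtain ⟨hr1, hp2, -, -⟩ := hc
  obtain ⟨κ, hκ, γ, hγ, hγ'⟩ := exists_isCyclotomic_isTopGenerator_isCyclotomicVariable_holds p
  obtain ⟨D⟩ := W.nonempty_selmerDualData_holds κ γ hγ
  haveI : NeZero (W.conductorNorm ℤ) := ⟨(W.conductorNorm_pos_holds).ne'⟩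
  obtain ⟨Dm⟩ := hpar W
  obtain ⟨ϖ, hϖpos, hϖ, -⟩ := Dm.exists_rat_mul_realPeriodRat_eq_plusPeriod
  obtain ⟨L, hL⟩ := exists_isSplitMultPAdicLFunctionOf hsplit Dm.isNewformOf
  obtain ⟨Dq⟩ := (nonempty_tateParameterData_iff_holds (W := W) (p := p)).mpr hsplit
  obtain ⟨Dh, hDh⟩ := exists_isSplitMultCanonical_holds W p hp2 Dq
  obtain ⟨s, hs⟩ := exists_rat_shaAn_eq_of_analyticRank_eq_one hGZ hGZK W hr1
  have hrank : W.mordellWeilRank = 1 := by rw [(hGZK W hr1.le).1, hr1]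
  obtain ⟨hordL, hval⟩ := hcert Dm.f Dm.isNewformOf ϖ hϖ L hL Dq Dh hDh
  exact Typed.X2.bsdp_of_thm16mult_split_of_canonical_certificate hWu hJs hGZK W p
    LInvariant_ne_zero_holds hr1.le hX Dq Dh hDh hκ hγ hγ' Dm.isNewformOf D ϖ hϖpos.ne' hϖ L hL
    (by rw [hrank]; exact hordL) (by rw [hrank]; exact hval) hs (hsha s hs)

/-! ## §2 Non-split multiplicative `p` (`ord_{T=0} L = 1`) -/

/-- **X2c, NON-split `p ‖ N`: `BSD(E,p)` from Kato–Wuthrich + Stein–Wuthrich + the pair's L3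
certificate — datum-free door.** As §1 with Stein–Wuthrich Thm. 6.1 non-split (`hJn`), THE non-split
Mazur–Tate–Teitelbaum function (`IsMultPAdicLFunctionOf f p (-1) L`,
`exists_isMultPAdicLFunctionOf_neg_one_of_nonsplit`), the Tate parameter `q`
(`existsUnique_tateJ_eq_of_one_lt_norm`) and THE §4.2 height for `q` (`exists_isMultCanonical_holds`);
certificate `ord_{T=0} L = 1` and `v_p(ϖ·[T¹]L·log_p(γ_cyc)·#tors²) = v_p(2·∏c_v·Reg_p)`; `hsha`.
[cite: Wuthrich2014, Thm. 16 (p. 397)] [cite: SteinWuthrich2013, Thm. 6.1 (p. 20), §3.1 (p. 9), §4.2]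
[cite: Miller2011LMS, Def. 1.1 and Prop. 7.6] -/
theorem bsdp_of_cellC_of_not_split_of_thm16_of_l3Certificate
    (hWu : thm16_charIdeal_dvd_multiplicative_of_reducible) (hJn : thm61_nonsplitMultiplicative)
    (hGZ : GrossZagier1986_thm_I_7_3) (hGZK : rank_eq_analyticRank_of_analyticRank_le_one)
    (hpar : nonempty_modularParametrizationData)
    (hc : CellC W p) (hns : ¬ W.HasSplitMultiplicativeReductionAtPrime p)
    (hcert : ∀ {N : ℕ} [NeZero N] (f : CuspForm (Gamma0 N) 2), IsNewformOf W f →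
      ∀ (ϖ : ℚ), (ϖ : ℝ) * W.realPeriodRat = plusPeriod f →
      ∀ (L : PowerSeries ℚ_[p]), IsMultPAdicLFunctionOf f p (-1) L →
      ∀ (q : ℚ_[p]), q ≠ 0 → ‖q‖ < 1 → tateJ q = (W.j : ℚ_[p]) →
      ∀ (Dh : PAdicHeightData W p), IsMultCanonical Dh q →
        L.order = ((1 : ℕ) : ℕ∞) ∧
        (((ϖ : ℚ) : ℚ_[p]) * PowerSeries.coeff 1 L *
            (padicLog p (cyclotomicGenerator p) ^ 1 * (W.torsionOrder : ℚ_[p]) ^ 2)).valuation =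
          (2 * (W.tamagawaProduct : ℚ_[p]) * padicRegulator Dh).valuation)
    (hsha : ∀ s : ℚ, shaAn W = (s : ℂ) → padicValRat p s = 0) :
    BSDp W p := by
  have hX : ClassX2 W p := hc.2
  obtain ⟨hr1, hp2, -, hmult⟩ := hc
  obtain ⟨κ, hκ, γ, hγ, hγ'⟩ := exists_isCyclotomic_isTopGenerator_isCyclotomicVariable_holds p
  obtain ⟨D⟩ := W.nonempty_selmerDualData_holds κ γ hγ
  haveI : NeZero (W.conductorNorm ℤ) := ⟨(W.conductorNorm_pos_holds).ne'⟩
  obtain ⟨Dm⟩ := hpar W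
  obtain ⟨ϖ, hϖpos, hϖ, -⟩ := Dm.exists_rat_mul_realPeriodRat_eq_plusPeriod
  obtain ⟨L, hL⟩ := exists_isMultPAdicLFunctionOf_neg_one_of_nonsplit Dm.isNewformOf hmult hns
  obtain ⟨q, ⟨hq0, hq1, hqj⟩, -⟩ := existsUnique_tateJ_eq_of_one_lt_norm
    (one_lt_norm_j_of_hasMultiplicativeReductionAtPrime (W := W) (p := p) hmult)
  obtain ⟨Dh, hDh⟩ := exists_isMultCanonical_holds W p hp2 hmult hns q hq0 hq1 hqj
  obtain ⟨s, hs⟩ := exists_rat_shaAn_eq_of_analyticRank_eq_one hGZ hGZK W hr1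
  have hrank : W.mordellWeilRank = 1 := by rw [(hGZK W hr1.le).1, hr1]
  obtain ⟨hordL, hval⟩ := hcert Dm.f Dm.isNewformOf ϖ hϖ L hL q hq0 hq1 hqj Dh hDh
  exact Typed.X2.bsdp_of_thm16mult_nonsplit_of_canonical_certificate hWu hJn hGZK W p hr1.le hX hns
    hq0 hq1 hqj Dh hDh hκ hγ hγ' Dm.isNewformOf D ϖ hϖpos.ne' hϖ L hL
    (by rw [hrank]; exact hordL) (by rw [hrank]; exact hval) hs (hsha s hs)

/-! ## §3 (gen 2) The ORDER reading is THEORY + ONE COEFFICIENT: doors taking `[T^(1+e)]L ≠ 0` instead of `ord_{T=0} L = 1+e`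

In the shape consumed by the `p`-adic certificate engine (`Typed.noPTorsion_of_leadingTerm_certificate`),
Wuthrich's Thm. 16 gives `ϖ·L = T^e·ι(g)` with `g ∈ (f_E) = char_Λ X` (`e = 1` split / `0` non-split) and the
tree PROVES `T^r ∣ f_E` (`X_pow_mordellWeilRank_dvd_of_charIdeal_eq_span`, `r = rank E(ℚ)`); hence
`T^(r+e) ∣ ϖ·L` and `ord_{T=0} L ≥ r + e` is a THEOREM — the only instrument content of the reading
`ord_{T=0} L = r + e` is `[T^(r+e)]L ≠ 0`, which is exactly what an EXACT valuation read of that coefficient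
(engine B: Mazur–Tate element `[T^(1+e)]θ_K ≢ 0 mod p^(K−1)` ‖ engine C) delivers. The two doors below are
§1/§2 with `hcert`'s first conjunct weakened accordingly (seat bsd-eis-k5-p3 gen 2, «B11-L3CW»). -/

/-- **Order from one coefficient, in the engine shape**: if `c·L = T^e·ι(g)`, `g ∈ (fE)`, `T^k ∣ fE`,
`c ≠ 0` and `[T^(k+e)]L ≠ 0`, then `ord_{T=0} L = k + e`. [folklore] -/
theorem order_eq_of_coeff_ne_zero_of_engineShape (fE g : IwasawaAlgebra p)
    (hg : g ∈ Ideal.span {fE}) (L : PowerSeries ℚ_[p]) (c : ℚ_[p]) (hc : c ≠ 0) (e k : ℕ)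
    (hι : PowerSeries.C c * L = PowerSeries.X ^ e * iwasawaToPowerSeries p g)
    (hXk : (PowerSeries.X : IwasawaAlgebra p) ^ k ∣ fE)
    (hcoeff : PowerSeries.coeff (k + e) L ≠ 0) : L.order = ((k + e : ℕ) : ℕ∞) := by
  obtain ⟨h, hgh⟩ := Ideal.mem_span_singleton'.mp hg
  obtain ⟨q, hq⟩ := hXk
  refine le_antisymm (PowerSeries.order_le _ hcoeff) ?_
  refine PowerSeries.le_order L _ (fun i hi => ?_)
  have hi' : i < k + e := by exact_mod_cast hi
  have h1 : PowerSeries.coeff i (PowerSeries.C c * L) = c * PowerSeries.coeff i L :=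
    PowerSeries.coeff_C_mul _ _ _
  have h2 : PowerSeries.coeff i (PowerSeries.X ^ e * iwasawaToPowerSeries p g) = 0 := by
    rw [PowerSeries.coeff_X_pow_mul']
    split_ifs with hei
    · rw [coeff_iwasawaToPowerSeries p g, ← hgh, hq,
        show h * (PowerSeries.X ^ k * q) = PowerSeries.X ^ k * (h * q) by ring,
        PowerSeries.coeff_X_pow_mul', if_neg (by omega)]
      rfl
    · rfl
  have h3 : c * PowerSeries.coeff i L = 0 := by rw [← h1, hι, h2]
  rcases mul_eq_zero.mp h3 with h0 | h0
  · exact absurd h0 hc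
  · exact h0

/-- **X2c, SPLIT `p ‖ N` — §1 with the COEFFICIENT reading**: `hcert` asks `[T²]L ≠ 0` (instead of
`ord_{T=0} L = 2`, whose `≥` half is the theorem above) and the valuation identity
`v_p(ϖ·[T²]L·log_p(γ_cyc)²·#tors²) = v_p(𝓛_p·∏c_v·Reg_p)`; plus `hsha`. [cite: Wuthrich2014, Thm. 16 (p. 397)]
[cite: SteinWuthrich2013, Thm. 6.1 (p. 20) and §4.2] [cite: Miller2011LMS, Def. 1.1 and Prop. 7.6] -/
theorem bsdp_of_cellC_of_split_of_thm16_of_l3CoeffCertificate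
    (hWu : thm16_charIdeal_dvd_multiplicative_of_reducible) (hJs : thm61_splitMultiplicative)
    (hGZ : GrossZagier1986_thm_I_7_3) (hGZK : rank_eq_analyticRank_of_analyticRank_le_one)
    (hpar : nonempty_modularParametrizationData)
    (hc : CellC W p) (hsplit : W.HasSplitMultiplicativeReductionAtPrime p)
    (hcert : ∀ {N : ℕ} [NeZero N] (f : CuspForm (Gamma0 N) 2), IsNewformOf W f →
      ∀ (ϖ : ℚ), (ϖ : ℝ) * W.realPeriodRat = plusPeriod f →
      ∀ (L : PowerSeries ℚ_[p]), IsSplitMultPAdicLFunctionOf f p L →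
      ∀ (Dq : TateParameterData W p) (Dh : PAdicHeightData W p), IsSplitMultCanonical Dh Dq →
        PowerSeries.coeff 2 L ≠ 0 ∧
        (((ϖ : ℚ) : ℚ_[p]) * PowerSeries.coeff 2 L *
            (padicLog p (cyclotomicGenerator p) ^ 2 * (W.torsionOrder : ℚ_[p]) ^ 2)).valuation =
          (LInvariant Dq * (W.tamagawaProduct : ℚ_[p]) * padicRegulator Dh).valuation)
    (hsha : ∀ s : ℚ, shaAn W = (s : ℂ) → padicValRat p s = 0) :
    BSDp W p := by
  have hX : ClassX2 W p := hc.2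
  have hred : ¬ W.HasIrreducibleModPGaloisRep p := hX.2.1
  obtain ⟨hr1, hp2, -, -⟩ := hc
  obtain ⟨κ, hκ, γ, hγ, hγ'⟩ := exists_isCyclotomic_isTopGenerator_isCyclotomicVariable_holds p
  obtain ⟨D⟩ := W.nonempty_selmerDualData_holds κ γ hγ
  haveI : NeZero (W.conductorNorm ℤ) := ⟨(W.conductorNorm_pos_holds).ne'⟩
  obtain ⟨Dm⟩ := hpar W
  obtain ⟨ϖ, hϖpos, hϖ, -⟩ := Dm.exists_rat_mul_realPeriodRat_eq_plusPeriod
  obtain ⟨L, hL⟩ := exists_isSplitMultPAdicLFunctionOf hsplit Dm.isNewformOf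
  obtain ⟨Dq⟩ := (nonempty_tateParameterData_iff_holds (W := W) (p := p)).mpr hsplit
  obtain ⟨Dh, hDh⟩ := exists_isSplitMultCanonical_holds W p hp2 Dq
  obtain ⟨s, hs⟩ := exists_rat_shaAn_eq_of_analyticRank_eq_one hGZ hGZK W hr1
  have hrank : W.mordellWeilRank = 1 := by rw [(hGZK W hr1.le).1, hr1]
  obtain ⟨hcoeff, hval⟩ := hcert Dm.f Dm.isNewformOf ϖ hϖ L hL Dq Dh hDh
  -- `ord_{T=0} L = rank + 1` from Thm. 16's engine shape, `T^rank ∣ f_E`, and `[T²]L ≠ 0`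
  haveI : Module.Finite (IwasawaAlgebra p) D.X := D.module_finite_holds hγ
  have hXt : D.IsTorsion :=
    thm16_charIdeal_dvd_multiplicative_of_reducible.isTorsion hWu W p hp2
      hsplit.hasMultiplicativeReductionAtPrime hred hκ hγ hγ' Dm.isNewformOf D ϖ hϖ
  obtain ⟨fE, g, hchar, hg, hι⟩ :=
    thm16_charIdeal_dvd_multiplicative_of_reducible.exists_generator_engine_shape_split hWu W p hp2
      hsplit hred hκ hγ hγ' Dm.isNewformOf D ϖ hϖ L hL
  have hXk := X_pow_mordellWeilRank_dvd_of_charIdeal_eq_span W p hγ D hXt hchar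
  have hϖQ : ((ϖ : ℚ) : ℚ_[p]) ≠ 0 := by exact_mod_cast hϖpos.ne'
  have hordL : L.order = ((W.mordellWeilRank + 1 : ℕ) : ℕ∞) :=
    order_eq_of_coeff_ne_zero_of_engineShape p fE g hg L _ hϖQ 1 W.mordellWeilRank hι hXk
      (by rw [hrank]; exact hcoeff)
  exact Typed.X2.bsdp_of_thm16mult_split_of_canonical_certificate hWu hJs hGZK W p
    LInvariant_ne_zero_holds hr1.le hX Dq Dh hDh hκ hγ hγ' Dm.isNewformOf D ϖ hϖpos.ne' hϖ L hL
    hordL (by rw [hrank]; exact hval) hs (hsha s hs)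

/-- **X2c, NON-split `p ‖ N` — §2 with the COEFFICIENT reading**: `hcert` asks `[T¹]L ≠ 0` (instead of
`ord_{T=0} L = 1`) and `v_p(ϖ·[T¹]L·log_p(γ_cyc)·#tors²) = v_p(2·∏c_v·Reg_p)`; plus `hsha`.
[cite: Wuthrich2014, Thm. 16 (p. 397)] [cite: SteinWuthrich2013, Thm. 6.1 (p. 20), §3.1 (p. 9), §4.2]
[cite: Miller2011LMS, Def. 1.1 and Prop. 7.6] -/
theorem bsdp_of_cellC_of_not_split_of_thm16_of_l3CoeffCertificate
    (hWu : thm16_charIdeal_dvd_multiplicative_of_reducible) (hJn : thm61_nonsplitMultiplicative)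
    (hGZ : GrossZagier1986_thm_I_7_3) (hGZK : rank_eq_analyticRank_of_analyticRank_le_one)
    (hpar : nonempty_modularParametrizationData)
    (hc : CellC W p) (hns : ¬ W.HasSplitMultiplicativeReductionAtPrime p)
    (hcert : ∀ {N : ℕ} [NeZero N] (f : CuspForm (Gamma0 N) 2), IsNewformOf W f →
      ∀ (ϖ : ℚ), (ϖ : ℝ) * W.realPeriodRat = plusPeriod f →
      ∀ (L : PowerSeries ℚ_[p]), IsMultPAdicLFunctionOf f p (-1) L →
      ∀ (q : ℚ_[p]), q ≠ 0 → ‖q‖ < 1 → tateJ q = (W.j : ℚ_[p]) →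
      ∀ (Dh : PAdicHeightData W p), IsMultCanonical Dh q →
        PowerSeries.coeff 1 L ≠ 0 ∧
        (((ϖ : ℚ) : ℚ_[p]) * PowerSeries.coeff 1 L *
            (padicLog p (cyclotomicGenerator p) ^ 1 * (W.torsionOrder : ℚ_[p]) ^ 2)).valuation =
          (2 * (W.tamagawaProduct : ℚ_[p]) * padicRegulator Dh).valuation)
    (hsha : ∀ s : ℚ, shaAn W = (s : ℂ) → padicValRat p s = 0) :
    BSDp W p := by
  have hX : ClassX2 W p := hc.2
  obtain ⟨hr1, hp2, hred, hmult⟩ := hc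
  obtain ⟨κ, hκ, γ, hγ, hγ'⟩ := exists_isCyclotomic_isTopGenerator_isCyclotomicVariable_holds p
  obtain ⟨D⟩ := W.nonempty_selmerDualData_holds κ γ hγ
  haveI : NeZero (W.conductorNorm ℤ) := ⟨(W.conductorNorm_pos_holds).ne'⟩
  obtain ⟨Dm⟩ := hpar W
  obtain ⟨ϖ, hϖpos, hϖ, -⟩ := Dm.exists_rat_mul_realPeriodRat_eq_plusPeriod
  obtain ⟨L, hL⟩ := exists_isMultPAdicLFunctionOf_neg_one_of_nonsplit Dm.isNewformOf hmult hns
  obtain ⟨q, ⟨hq0, hq1, hqj⟩, -⟩ := existsUnique_tateJ_eq_of_one_lt_norm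
    (one_lt_norm_j_of_hasMultiplicativeReductionAtPrime (W := W) (p := p) hmult)
  obtain ⟨Dh, hDh⟩ := exists_isMultCanonical_holds W p hp2 hmult hns q hq0 hq1 hqj
  obtain ⟨s, hs⟩ := exists_rat_shaAn_eq_of_analyticRank_eq_one hGZ hGZK W hr1
  have hrank : W.mordellWeilRank = 1 := by rw [(hGZK W hr1.le).1, hr1]
  obtain ⟨hcoeff, hval⟩ := hcert Dm.f Dm.isNewformOf ϖ hϖ L hL q hq0 hq1 hqj Dh hDh
  -- `ord_{T=0} L = rank` from Thm. 16's engine shape (e = 0), `T^rank ∣ f_E`, and `[T¹]L ≠ 0`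
  haveI : Module.Finite (IwasawaAlgebra p) D.X := D.module_finite_holds hγ
  have hXt : D.IsTorsion :=
    thm16_charIdeal_dvd_multiplicative_of_reducible.isTorsion hWu W p hp2 hmult hred hκ hγ hγ'
      Dm.isNewformOf D ϖ hϖ
  obtain ⟨fE, g, hchar, hg, hι⟩ :=
    thm16_charIdeal_dvd_multiplicative_of_reducible.exists_generator_engine_shape_nonsplit hWu W p hp2
      hmult hns hred hκ hγ hγ' Dm.isNewformOf D ϖ hϖ L hL
  have hXk := X_pow_mordellWeilRank_dvd_of_charIdeal_eq_span W p hγ D hXt hchar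
  have hϖQ : ((ϖ : ℚ) : ℚ_[p]) ≠ 0 := by exact_mod_cast hϖpos.ne'
  have hordL : L.order = ((W.mordellWeilRank : ℕ) : ℕ∞) := by
    have h := order_eq_of_coeff_ne_zero_of_engineShape p fE g hg L _ hϖQ 0 W.mordellWeilRank hι hXk
      (by rw [hrank]; exact hcoeff)
    simpa only [Nat.add_zero] using h
  exact Typed.X2.bsdp_of_thm16mult_nonsplit_of_canonical_certificate hWu hJn hGZK W p hr1.le hX hns
    hq0 hq1 hqj Dh hDh hκ hγ hγ' Dm.isNewformOf D ϖ hϖpos.ne' hϖ L hL hordL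
    (by rw [hrank]; exact hval) hs (hsha s hs)

end Summit.BirchSwinnertonDyer.BirchSwinnertonDyer.Theorems.B11L3

end
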